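import Literature.AnabelianGeometry.EtaleTheta.BiKummerOfModelCanonical
import Literature.AnabelianGeometry.EtaleTheta.FrdIVocabularyWeak
import Literature.AlgebraicGeometry.Frobenioids.PerfFactorialWeakCoprime

/-!
# [EtTh] Prop 4.2 (i), (ii) at the model instances of the §4 setting from WEAK perf-factoriality, and
# hypothesis-free at the weak canonical vocabulary `treeMonoidVocabWeak`

Mochizuki, *The étale theta function …*, Publ. RIMS **45** (2009), §4, Prop. 4.2 (i)(ii), PDF p.88
(printed 314) [cite: MochizukiEtTh2009, Prop 4.2 p.88]; proof p.89 ("entirely similar" for (ii)); the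
bracket of Def. 4.1 (i), p.86: "`Div(s')`, `Div(s'')` have disjoint supports [cf. [FrdI], Proposition
4.1, (iii)]. [Thus, `Div(s')`, `Div(s'')` are uniquely determined by `f`.]"  abc-iut cell, layer L2, ROW
`EtTh:Prop4.2` (node `EtTh:Prop4.2(ii)`; W6 seat abc-iut-w6-d037), PROOF-ONLY companion of
`BiKummerRoots.lean` (abc-iut-L2-t3: `Prop42_i`, `Prop42_ii`), `Discharge/Sec4Model.lean` (abc-iut-L6-t12:
`prop42_i_mkOfModel(_coprime)`, `prop42_ii_mkOfModel(_coprime)`) and `BiKummerOfModelCanonical.lean`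
(abc-iut-L2-t9: `prop42_i_mkOfModelCanonical`, `prop42_ii_mkOfModelCanonical`).

THE RESIDUAL BINDER.  The landed canonical-model closers carry exactly one hypothesis,
`hpf : ∀ A, IsPerfFactorial (tf.Φ.carrier A)` — [FrdI] Def. 2.4 (i) AS PRINTED for every `Φ(A)` — used
only through `IsDivisorial` and the [FrdI] Prop. 4.1 (iii) cancellation law
`IsPerfFactorial.eq_of_mul_eq_mul_of_forall_common_dvd_eq_one` (`PerfFactorialCoprime.lean`).  Cell
finding F-L2d2-1 (abc-iut-L2-d2; `not_isPerfFactorial_multiplicative_pi_nat` p413961): at tempered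
coverings with infinitely many special-fibre components (`Ÿ`, `Z_∞` — the objects of §§4–5) clause (d)
fails, so `hpf` is unavailable there; the vocabulary of record is abc-iut-L2-t3's `treeMonoidVocabWeak`
("perf-factorial" := `IsPerfFactorialCof` = WEAKLY perf-factorial with cofinal perfection,
`FrdIVocabularyWeak.lean`; realified data `RealifiedDivisorMonoids.ofRlfZWeak`, abc-iut-L6-t12).  With
the weak cancellation law `IsPerfFactorialWeak.eq_of_mul_eq_mul_of_forall_common_dvd_eq_one`
(`Frobenioids/PerfFactorialWeakCoprime.lean`) this file proves:

* `prop42_i_mkOfModel_coprime_of_weak`, `prop42_ii_mkOfModel_coprime_of_weak`,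
  `prop42_i_mkOfModelCanonical_of_weak`, `prop42_ii_mkOfModelCanonical_of_weak` — the four landed
  closers with `hpf` WEAKENED to `∀ A, IsPerfFactorialWeak (tf.Φ.carrier A)`;
* (over `V = treeMonoidVocab` the binder IS the field `TemperedFrobenioid.isPerfFactorial`: the
  hypothesis-free closers `prop42_i/ii_mkOfModelCanonical_treeVocab` are abc-iut-f-108's,
  `Discharge/Sec4Prop42Schema.lean`, FACT-LIST rows F-0488/F-0489 — cited, not repeated;)
* `prop42_i_mkOfModelCanonical_treeVocabWeak`, `prop42_ii_mkOfModelCanonical_treeVocabWeak` — over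
  `V = treeMonoidVocabWeak` the field gives `IsPerfFactorialCof ⇒ IsPerfFactorialWeak`: NO hypothesis.

So [EtTh] Prop. 4.2 (i) and (ii) AS TYPED hold OUTRIGHT for every canonical model instance
`mkOfModelCanonical` of the §4 setting over either canonical vocabulary — the inputs are the setting's
own data (`Φ` perfect, monoid type `ℤ`, Galois data, `A_⊙`), nothing else.  Theorems only (DEFS-FREEZE).
HONEST FRAMING: [EtTh] is a refereed pre-IUT paper; nothing here asserts that such data exist for an
actual curve; nothing here bears on [IUTchIII] Cor. 3.12.
-/

noncomputable section

namespace Literature.AnabelianGeometry.EtaleTheta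

open CategoryTheory Opposite Literature.AlgebraicGeometry.Frobenioids

universe u₀ v₀ u v w

variable {K : Type u₀} [Field K]

namespace BiKummerSetting

variable (X : SemiGraphs.TemperedArithmeticGroup.{u₀} K) {D₀ : Type u₀} [Category.{v₀} D₀]

section AbstractVocab

variable {V : FrdIMonoidStub.{w}} {T : RealifiedDivisorMonoids (D₀ := D₀) V} {D : Type u} [Category.{v} D]
  {VD : FrdICatStub.{u, v, w} D}

/-! ### DS1 from WEAK perf-factoriality -/

/-- DS1 (cancellation) for the [FrdI] Prop. 4.1 (iii) disjoint-supports predicate on a perfect WEAKLY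
perf-factorial `Φ(A)` — the weak twin of `ds_cancel_of_isPerfFactorial`.
[cite: MochizukiFrdI2008, Prop. 4.1 (iii) p.76] -/
theorem ds_cancel_of_isPerfFactorialWeak (tf : TemperedFrobenioid T D VD)
    (hpf : ∀ A : Dᵒᵖ, IsPerfFactorialWeak (tf.Φ.carrier A)) (hP : ∀ A : Dᵒᵖ, IsPerfect (tf.Φ.carrier A))
    {A : Dᵒᵖ} {a b a' b' : tf.Φ.carrier A} (hab : ∀ x : tf.Φ.carrier A, x ∣ a → x ∣ b → x = 1)
    (hab' : ∀ x : tf.Φ.carrier A, x ∣ a' → x ∣ b' → x = 1) (e : a * b' = a' * b) :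
    a = a' ∧ b = b' :=
  (hpf A).eq_of_mul_eq_mul_of_forall_common_dvd_eq_one (hP A) hab hab' e

/-! ### Prop 4.2 (i), (ii) for `mkOfModel` with the Prop 4.1 (iii) predicate, weak hypothesis -/

variable (tf : TemperedFrobenioid T D VD) (hZ : tf.monoidType = MonoidType.Z)
  (hP : ∀ A : Dᵒᵖ, IsPerfect (tf.Φ.carrier A)) (hBΛ : ∀ (Y : D₀ᵒᵖ) (b : T.BΛ.obj Y), IsUnit b)
  (IG : D → Prop) (gS : ∀ A : D, IG A → (X.Pi →* Aut A))
  (gSs : ∀ (A : D) (h : IG A), Function.Surjective (gS A h))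
  (NH : Subgroup (Field.absoluteGaloisGroup K) → tf.category → ℕ+ → Prop)
  (AB : ∀ {A B : tf.category}, Subgroup (Aut A) → (A ⟶ A) → (A ⟶ B) → Prop) (A₀ : tf.category)
  (hA₀ : PreFrobenioid.IsFrobeniusTrivial tf.toElem A₀) (hA₀' : IG A₀.base)

/-- **[EtTh] Prop. 4.2 (i) for the model instance with the [FrdI] Prop. 4.1 (iii) disjoint-supports
predicate, from WEAK perf-factoriality**: abc-iut-L6-t12's `prop42_i_mkOfModel_coprime` with
`hpf : ∀ A, IsPerfFactorial (Φ(A))` weakened to `∀ A, IsPerfFactorialWeak (Φ(A))`.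
[cite: MochizukiEtTh2009, Prop 4.2(i) p.88] -/
theorem prop42_i_mkOfModel_coprime_of_weak (hpf : ∀ A : Dᵒᵖ, IsPerfFactorialWeak (tf.Φ.carrier A)) :
    (mkOfModel X tf hZ hP hBΛ (fun {A} a b => ∀ x : tf.Φ.carrier A, x ∣ a → x ∣ b → x = 1) IG gS gSs NH
      AB A₀ hA₀ hA₀').Prop42_i :=
  prop42_i_mkOfModel X tf hZ hP hBΛ _ IG gS gSs NH AB A₀ hA₀ hA₀' (fun A => (hpf (op A)).isDivisorial)
    (fun hab hab' e => ds_cancel_of_isPerfFactorialWeak tf hpf hP hab hab' e)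

/-- **[EtTh] Prop. 4.2 (ii) for the model instance with the [FrdI] Prop. 4.1 (iii) disjoint-supports
predicate, from WEAK perf-factoriality** (necessity and uniqueness, as typed): abc-iut-L6-t12's
`prop42_ii_mkOfModel_coprime` with `hpf` weakened to `∀ A, IsPerfFactorialWeak (Φ(A))`.
[cite: MochizukiEtTh2009, Prop 4.2(ii) p.88] -/
theorem prop42_ii_mkOfModel_coprime_of_weak (hpf : ∀ A : Dᵒᵖ, IsPerfFactorialWeak (tf.Φ.carrier A)) :
    (mkOfModel X tf hZ hP hBΛ (fun {A} a b => ∀ x : tf.Φ.carrier A, x ∣ a → x ∣ b → x = 1) IG gS gSs NH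
      AB A₀ hA₀ hA₀').Prop42_ii :=
  prop42_ii_mkOfModel X tf hZ hP hBΛ _ IG gS gSs NH AB A₀ hA₀ hA₀' (fun A => (hpf (op A)).isDivisorial)
    (fun hab hab' e => ds_cancel_of_isPerfFactorialWeak tf hpf hP hab hab' e)
    (fun e _ _ _ hab => ds_pull_of_isIso tf e hab)

/-! ### Prop 4.2 (i), (ii) for the canonical model instance `mkOfModelCanonical`, weak hypothesis -/

/-- **[EtTh] Prop. 4.2 (i) for the canonical model instance, from WEAK perf-factoriality**:
abc-iut-L2-t9's `prop42_i_mkOfModelCanonical` with `hpf` weakened to `∀ A, IsPerfFactorialWeak (Φ(A))`.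
[cite: MochizukiEtTh2009, Prop 4.2(i) p.88] -/
theorem prop42_i_mkOfModelCanonical_of_weak (hpf : ∀ A : Dᵒᵖ, IsPerfFactorialWeak (tf.Φ.carrier A)) :
    (mkOfModelCanonical X tf hZ hP IG gS gSs NH A₀ hA₀ hA₀').Prop42_i :=
  prop42_i_mkOfModel_coprime_of_weak X tf hZ hP T.isUnit_BΛ IG gS gSs NH _ A₀ hA₀ hA₀' hpf

/-- **[EtTh] Prop. 4.2 (ii) for the canonical model instance, from WEAK perf-factoriality** (necessity
and uniqueness, as typed): abc-iut-L2-t9's `prop42_ii_mkOfModelCanonical` with `hpf` weakened to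
`∀ A, IsPerfFactorialWeak (Φ(A))`. [cite: MochizukiEtTh2009, Prop 4.2(ii) p.88] -/
theorem prop42_ii_mkOfModelCanonical_of_weak (hpf : ∀ A : Dᵒᵖ, IsPerfFactorialWeak (tf.Φ.carrier A)) :
    (mkOfModelCanonical X tf hZ hP IG gS gSs NH A₀ hA₀ hA₀').Prop42_ii :=
  prop42_ii_mkOfModel_coprime_of_weak X tf hZ hP T.isUnit_BΛ IG gS gSs NH _ A₀ hA₀ hA₀' hpf

/-- The landed (strong-hypothesis) closer is the special case `IsPerfFactorial ⇒ IsPerfFactorialWeak`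
(`IsPerfFactorial.weak`) — shape check, proves nothing new. [cite: MochizukiEtTh2009, Prop 4.2(ii) p.88] -/
example (hpf : ∀ A : Dᵒᵖ, IsPerfFactorial (tf.Φ.carrier A)) :
    (mkOfModelCanonical X tf hZ hP IG gS gSs NH A₀ hA₀ hA₀').Prop42_ii :=
  prop42_ii_mkOfModelCanonical_of_weak X tf hZ hP IG gS gSs NH A₀ hA₀ hA₀' fun A => (hpf A).weak

end AbstractVocab

/-! ### At the canonical vocabulary `treeMonoidVocab` ([FrdI] Def. 2.4 (i) as printed)

Over `V = treeMonoidVocab` the binder `hpf` IS the field `TemperedFrobenioid.isPerfFactorial`; the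
hypothesis-free closers `prop42_i_mkOfModelCanonical_treeVocab` / `prop42_ii_mkOfModelCanonical_treeVocab`
are abc-iut-f-108's (`Discharge/Sec4Prop42Schema.lean`, FACT-LIST rows F-0488/F-0489) and are not repeated
here. -/

/-! ### Hypothesis-free at the weak canonical vocabulary `treeMonoidVocabWeak` (F-L2d2-1 / F-L2d2-2)

The vocabulary is named explicitly in the statements (`Prop42_i (V := treeMonoidVocabWeak) …`) so that
they read — and hash — differently from the `treeMonoidVocab` closers of `Sec4Prop42Schema.lean`. -/

section TreeVocabWeak

variable {T : RealifiedDivisorMonoids (D₀ := D₀) treeMonoidVocabWeak.{w}} {D : Type u} [Category.{v} D]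
  {VD : FrdICatStub.{u, v, w} D} (tf : TemperedFrobenioid T D VD) (hZ : tf.monoidType = MonoidType.Z)
  (hP : ∀ A : Dᵒᵖ, IsPerfect (tf.Φ.carrier A)) (IG : D → Prop) (gS : ∀ A : D, IG A → (X.Pi →* Aut A))
  (gSs : ∀ (A : D) (h : IG A), Function.Surjective (gS A h))
  (NH : Subgroup (Field.absoluteGaloisGroup K) → tf.category → ℕ+ → Prop) (A₀ : tf.category)
  (hA₀ : PreFrobenioid.IsFrobeniusTrivial tf.toElem A₀) (hA₀' : IG A₀.base)

/-- Over `treeMonoidVocabWeak`, Def. 3.6 (ii)'s field "`Φ` … perf-factorial" reads `IsPerfFactorialCof`,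
whence every `Φ(A)` is WEAKLY perf-factorial. [cite: MochizukiEtTh2009, Def 3.6 p.77] -/
theorem isPerfFactorialWeak_of_treeVocabWeak (A : Dᵒᵖ) : IsPerfFactorialWeak (tf.Φ.carrier A) :=
  (tf.isPerfFactorial A).elim fun h _ => h

/-- **[EtTh] Prop. 4.2 (i), OUTRIGHT for the canonical model instance over `treeMonoidVocabWeak`** — the
vocabulary of record at tempered coverings with infinitely many special-fibre components (`Ÿ`, `Z_∞`),
where the printed perf-factoriality fails (F-L2d2-1): no hypothesis remains.
[cite: MochizukiEtTh2009, Prop 4.2(i) p.88] -/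
theorem prop42_i_mkOfModelCanonical_treeVocabWeak :
    Prop42_i (V := treeMonoidVocabWeak) (mkOfModelCanonical X tf hZ hP IG gS gSs NH A₀ hA₀ hA₀') :=
  prop42_i_mkOfModelCanonical_of_weak X tf hZ hP IG gS gSs NH A₀ hA₀ hA₀'
    (isPerfFactorialWeak_of_treeVocabWeak tf)

/-- **[EtTh] Prop. 4.2 (ii), OUTRIGHT for the canonical model instance over `treeMonoidVocabWeak`**
(necessity and uniqueness, as typed): no hypothesis remains. [cite: MochizukiEtTh2009, Prop 4.2(ii) p.88] -/
theorem prop42_ii_mkOfModelCanonical_treeVocabWeak :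
    Prop42_ii (V := treeMonoidVocabWeak) (mkOfModelCanonical X tf hZ hP IG gS gSs NH A₀ hA₀ hA₀') :=
  prop42_ii_mkOfModelCanonical_of_weak X tf hZ hP IG gS gSs NH A₀ hA₀ hA₀'
    (isPerfFactorialWeak_of_treeVocabWeak tf)

end TreeVocabWeak

end BiKummerSetting

end Literature.AnabelianGeometry.EtaleTheta

end
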